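import Literature.NumberTheory.LFunctions.Zhang2022.ObjectiveTwinEllKernelForm

/-!
# Zhang (2022) design-space objective, twin part 15: the SIGN CHART of the pencil `H(ℓ) = F_ℓ|span{k₁,k₂,k₃}` —
# positive semidefinite exactly for `ℓ ∈ [0, 1/3] ∪ {1}`

Y. Zhang, *Discrete mean estimates and the Landau–Siegel zero*, arXiv:2211.02515v1 (2022)
[Zhang2022LandauSiegel] — an unrefereed manuscript under adjudication. **This file SEARCHES and TYPES; it
makes no claim about Landau–Siegel zeros, about Theorems 1–2 of the manuscript, or about a repaired (2.32),
until a kernel theorem says so.** LANDAU–SIEGEL programme, cell `landau-siegel`, §A Lean twin; knife edge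
E*-ℓ (theory/KNIFE-EDGES.md §1) on the AFE span.

Part 6 (`ObjectiveTwinEllKernelForm`) gave the continued main-term form `F_ℓ = mainTermFormEll ℓ` on the span
`K = span_ℂ{k₁,k₂,k₃}` of the three AFE directions `k_j(y) = e^{−iπjy}` (`= ker 𝔅`, `MainTermFormKernel`) as the
explicit Hermitian pencil `H(ℓ)(x) = ellFormQ ℓ x₁ x₂ x₃` (tridiagonal: real diagonal `8π(1−ℓ)(1−2ℓ)(1−3ℓ)`,
`8π(2−ℓ)(1−ℓ)(2−3ℓ)`, `8π(3−ℓ)(3−2ℓ)(1−ℓ)`, purely imaginary nearest-neighbour couplings of size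
`32(1−ℓ)²|1−3ℓ|`, `32(1−ℓ)²(3−ℓ)`, no `(1,3)` entry), and recorded: `H(1) = 0`; `F_ℓ(k₁) < 0` for `ℓ > 1`
(CONTROL C2, `mainTermFormEll_neg_of_one_lt`); `H(½)`, `H(⅔)` indefinite (`mainTermFormEll_half_witness`,
`_twoThirds_witness`, ls-ref-1's sign box); and `H(ℓ) ≥ 0` on the wall-vanishing plane `Σx_j = 0` for `0 < ℓ ≤ 1`
(part 13, `ellFormQ_nonneg_of_wallVanishing`). This file completes the picture on the whole span, for `ℓ ≥ 0`:

  `(∀ x, 0 ≤ H(ℓ)(x))  ↔  ℓ ≤ 1/3 ∨ ℓ = 1`                                   (`ellFormQ_nonneg_iff`)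

* `ellFormQ_nonneg_of_le_third` — for `0 ≤ ℓ ≤ 1/3` the pencil is PSD on all of `ℂ³` (proof: `|Im(x₁x̄₂)| ≤ |x₁||x₂|`
  reduces to the real tridiagonal form; `4d₃·Q = (2d₃r₃ − c₂₃r₂)² + binary form` whose discriminant is `−16d₃·Δ`,
  `Δ = 2048π(1−ℓ)³(3−ℓ)(1−3ℓ)·[π²(1−2ℓ)(2−ℓ)(2−3ℓ)(3−2ℓ) − 32(1−ℓ)²(3−9ℓ+4ℓ²)] ≥ 0` there — `π > 3` suffices);
  at the endpoint `k₁` is a null direction: `ellFormQ_third_afeDir_one` (`H(1/3)(x₁,0,0) = 0`);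
* `ellFormQ_neg_exists_of_third_lt_lt_one` — for `1/3 < ℓ < 1` the pencil is INDEFINITE: the `2×2` block on
  `span{k₁,k₂}` has `4d₁d₂ − c₁₂² = 256(1−ℓ)²(1−3ℓ)·[π²(1−2ℓ)(2−ℓ)(2−3ℓ) + 16(1−ℓ)²(3ℓ−1)] < 0`
  (`four_d12_sub_c12_sq_neg`), witnesses `(2d₂, −i·c₁₂, 0)` on `(1/3, ½]` and `(−c₁₂, 2i·d₁, 0)` on `(½, 1)`
  (`ellFormQ_witness12`); for `ℓ > 1`, `k₁` itself (`ellFormQ_afeDir_one_neg_of_one_lt`);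
* transported to profiles: `mainTermFormEll_afeSpan_nonneg_iff` (`F_ℓ(x₁k₁+x₂k₂+x₃k₃) ≥ 0 ∀x ↔ ℓ ≤ 1/3 ∨ ℓ = 1`).

READING (bookkeeping for KNIFE-EDGES §1, no claim beyond the continued calculus): on the AFE span the `ℓ`-knife is
TWO-SIDED — every `ℓ ∈ (1/3, 1) ∪ (1, ∞)` makes `H(ℓ)` indefinite, `ℓ = 1` is the only PSD point above `1/3`; below
`ℓ = 1` the negative directions all have `u(1⁻) ≠ 0` (part 13: PSD on `Σx_j = 0`), i.e. they need mollifier support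
beyond the reflection wall (E*-len), above `ℓ = 1` they include the wall-value-free `k₁ − k₃`-type directions only
through `k₁` (part 6). For `ℓ ≤ 1/3` (all three deformed frequencies `jℓ ≤ 1`) positivity returns. Far on the
unphysical side (`ℓ ≲ −4`) the form is indefinite again — not treated (`ℓ ≥ 0` throughout).
Theorems only; no new definitions.
-/

noncomputable section

open Real Complex ComplexConjugate

namespace Literature.NumberTheory.LFunctions.Zhang2022

namespace Objective

/-! ## Two real-variable positivity lemmas -/

/-- A real binary form `a x² + b x y + c y²` with `a, c ≥ 0` and `b² ≤ 4ac` is `≥ 0`. [folklore] -/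
private theorem binary_nonneg {a b c : ℝ} (ha : 0 ≤ a) (hc : 0 ≤ c) (hd : b ^ 2 ≤ 4 * a * c) (x y : ℝ) :
    0 ≤ a * x ^ 2 + b * x * y + c * y ^ 2 := by
  rcases eq_or_lt_of_le ha with h0 | hpos
  · -- `a = 0` forces `b = 0`
    have hb : b = 0 := by
      rw [← h0] at hd
      nlinarith [sq_nonneg b]
    rw [← h0, hb]
    nlinarith [sq_nonneg y]
  · -- `4a·form = (2ax + by)² + (4ac − b²)y²`
    have key : 4 * a * (a * x ^ 2 + b * x * y + c * y ^ 2) = (2 * a * x + b * y) ^ 2 + (4 * a * c - b ^ 2) * y ^ 2 := by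
      ring
    have h4 : 0 ≤ 4 * a * (a * x ^ 2 + b * x * y + c * y ^ 2) := by
      rw [key]; nlinarith [sq_nonneg (2 * a * x + b * y), sq_nonneg y]
    exact (mul_nonneg_iff_of_pos_left (by positivity : (0:ℝ) < 4 * a)).mp h4

/-- A real tridiagonal ternary form `d₁r₁² + p r₁r₂ + d₂r₂² + q r₂r₃ + d₃r₃²` with `d₁ ≥ 0`, `d₃ > 0`,
`q² ≤ 4d₂d₃` and `d₃p² ≤ d₁(4d₂d₃ − q²)` (`⇔` the determinant condition) is `≥ 0`. [folklore] -/
private theorem tridiag_nonneg {d₁ d₂ d₃ p q : ℝ} (h1 : 0 ≤ d₁) (h3 : 0 < d₃) (h23 : q ^ 2 ≤ 4 * d₂ * d₃)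
    (hΔ : d₃ * p ^ 2 ≤ d₁ * (4 * d₂ * d₃ - q ^ 2)) (r₁ r₂ r₃ : ℝ) :
    0 ≤ d₁ * r₁ ^ 2 + p * r₁ * r₂ + d₂ * r₂ ^ 2 + q * r₂ * r₃ + d₃ * r₃ ^ 2 := by
  -- `4d₃·Q = (2d₃r₃ + q r₂)² + [4d₁d₃ r₁² + 4d₃p r₁r₂ + (4d₂d₃ − q²) r₂²]`
  have key : 4 * d₃ * (d₁ * r₁ ^ 2 + p * r₁ * r₂ + d₂ * r₂ ^ 2 + q * r₂ * r₃ + d₃ * r₃ ^ 2) =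
      (2 * d₃ * r₃ + q * r₂) ^ 2
        + ((4 * d₁ * d₃) * r₁ ^ 2 + (4 * d₃ * p) * r₁ * r₂ + (4 * d₂ * d₃ - q ^ 2) * r₂ ^ 2) := by
    ring
  have hbin : 0 ≤ (4 * d₁ * d₃) * r₁ ^ 2 + (4 * d₃ * p) * r₁ * r₂ + (4 * d₂ * d₃ - q ^ 2) * r₂ ^ 2 := by
    refine binary_nonneg (by positivity) (by linarith) ?_ r₁ r₂
    -- `(4d₃p)² ≤ 4·(4d₁d₃)·(4d₂d₃ − q²)` ⇔ `d₃p² ≤ d₁(4d₂d₃ − q²)` (times `16d₃ > 0`)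
    nlinarith [mul_le_mul_of_nonneg_left hΔ (by positivity : (0:ℝ) ≤ 16 * d₃)]
  have h4 : 0 ≤ 4 * d₃ * (d₁ * r₁ ^ 2 + p * r₁ * r₂ + d₂ * r₂ ^ 2 + q * r₂ * r₃ + d₃ * r₃ ^ 2) := by
    rw [key]; nlinarith [sq_nonneg (2 * d₃ * r₃ + q * r₂)]
  exact (mul_nonneg_iff_of_pos_left (by positivity : (0:ℝ) < 4 * d₃)).mp h4

/-! ## From the Hermitian pencil to the real tridiagonal form -/

/-- `|Im(a b̄)| ≤ ‖a‖‖b‖`. [folklore] -/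
private theorem abs_im_mul_conj_le (a b : ℂ) : |(a * conj b).im| ≤ ‖a‖ * ‖b‖ := by
  have h := Complex.abs_im_le_norm (a * conj b)
  rwa [norm_mul, Complex.norm_conj] at h

/-- **Reduction to moduli**: `H(ℓ)(x) ≥ d₁‖x₁‖² + d₂‖x₂‖² + d₃‖x₃‖² − |c₁₂|‖x₁‖‖x₂‖ − |c₂₃|‖x₂‖‖x₃‖` with the
pencil's diagonal `d_j(ℓ)` and couplings `c₁₂ = 64(1−ℓ)²(1−3ℓ)`, `c₂₃ = 64(1−ℓ)²(3−ℓ)`.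
[cite: Zhang2022LandauSiegel, §2 (2.10), (2.13)] -/
theorem ellFormQ_ge_moduli (ℓ : ℝ) (x₁ x₂ x₃ : ℂ) :
    8 * π * ((1 - ℓ) * (1 - 2 * ℓ) * (1 - 3 * ℓ)) * ‖x₁‖ ^ 2
      + 8 * π * ((2 - ℓ) * (1 - ℓ) * (2 - 3 * ℓ)) * ‖x₂‖ ^ 2
      + 8 * π * ((3 - ℓ) * (3 - 2 * ℓ) * (1 - ℓ)) * ‖x₃‖ ^ 2
      - |64 * ((1 - ℓ) ^ 2 * (1 - 3 * ℓ))| * (‖x₁‖ * ‖x₂‖)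
      - |64 * ((1 - ℓ) ^ 2 * (3 - ℓ))| * (‖x₂‖ * ‖x₃‖) ≤ ellFormQ ℓ x₁ x₂ x₃ := by
  unfold ellFormQ
  have h12 : 64 * ((1 - ℓ) ^ 2 * (1 - 3 * ℓ)) * (x₁ * conj x₂).im
      ≤ |64 * ((1 - ℓ) ^ 2 * (1 - 3 * ℓ))| * (‖x₁‖ * ‖x₂‖) := by
    calc 64 * ((1 - ℓ) ^ 2 * (1 - 3 * ℓ)) * (x₁ * conj x₂).im
        ≤ |64 * ((1 - ℓ) ^ 2 * (1 - 3 * ℓ)) * (x₁ * conj x₂).im| := le_abs_self _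
      _ = |64 * ((1 - ℓ) ^ 2 * (1 - 3 * ℓ))| * |(x₁ * conj x₂).im| := abs_mul _ _
      _ ≤ |64 * ((1 - ℓ) ^ 2 * (1 - 3 * ℓ))| * (‖x₁‖ * ‖x₂‖) :=
          mul_le_mul_of_nonneg_left (abs_im_mul_conj_le x₁ x₂) (abs_nonneg _)
  have h23 : 64 * ((1 - ℓ) ^ 2 * (3 - ℓ)) * (x₂ * conj x₃).im
      ≤ |64 * ((1 - ℓ) ^ 2 * (3 - ℓ))| * (‖x₂‖ * ‖x₃‖) := by
    calc 64 * ((1 - ℓ) ^ 2 * (3 - ℓ)) * (x₂ * conj x₃).im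
        ≤ |64 * ((1 - ℓ) ^ 2 * (3 - ℓ)) * (x₂ * conj x₃).im| := le_abs_self _
      _ = |64 * ((1 - ℓ) ^ 2 * (3 - ℓ))| * |(x₂ * conj x₃).im| := abs_mul _ _
      _ ≤ |64 * ((1 - ℓ) ^ 2 * (3 - ℓ))| * (‖x₂‖ * ‖x₃‖) :=
          mul_le_mul_of_nonneg_left (abs_im_mul_conj_le x₂ x₃) (abs_nonneg _)
  linarith

/-! ## PSD on `[0, 1/3]` -/

/-- The `(2,3)` Schur condition on `[0, 1/3]`: `c₂₃² ≤ 4d₂d₃`, i.e.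
`4096(1−ℓ)⁴(3−ℓ)² ≤ 256π²(1−ℓ)²(2−ℓ)(2−3ℓ)(3−ℓ)(3−2ℓ)` (`π > 3` suffices). [cite: Zhang2022LandauSiegel, §2 (2.10), (2.13)] -/
theorem c23_sq_le_four_d23 {ℓ : ℝ} (h0 : 0 ≤ ℓ) (h : ℓ ≤ 1 / 3) :
    (-(64 * ((1 - ℓ) ^ 2 * (3 - ℓ)))) ^ 2 ≤
      4 * (8 * π * ((2 - ℓ) * (1 - ℓ) * (2 - 3 * ℓ))) * (8 * π * ((3 - ℓ) * (3 - 2 * ℓ) * (1 - ℓ))) := by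
  have hpi := Real.pi_gt_three
  -- factor: RHS − LHS = 256(1−ℓ)²(3−ℓ)·[π²(2−ℓ)(2−3ℓ)(3−2ℓ) − 16(1−ℓ)²(3−ℓ)]
  have hX : 0 ≤ (2 - ℓ) * (2 - 3 * ℓ) * (3 - 2 * ℓ) := by
    have a : 0 ≤ 2 - ℓ := by linarith
    have b : 0 ≤ 2 - 3 * ℓ := by linarith
    have c : 0 ≤ 3 - 2 * ℓ := by linarith
    positivity
  have hbr : 0 ≤ π ^ 2 * ((2 - ℓ) * (2 - 3 * ℓ) * (3 - 2 * ℓ)) - 16 * (1 - ℓ) ^ 2 * (3 - ℓ) := by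
    have h9 : 9 * ((2 - ℓ) * (2 - 3 * ℓ) * (3 - 2 * ℓ)) ≤ π ^ 2 * ((2 - ℓ) * (2 - 3 * ℓ) * (3 - 2 * ℓ)) :=
      mul_le_mul_of_nonneg_right (by nlinarith) hX
    -- `9(2−ℓ)(2−3ℓ)(3−2ℓ) − 16(1−ℓ)²(3−ℓ) = 60 − 176ℓ + 145ℓ² − 38ℓ³ ≥ 0` on `[0, 1/3]`
    nlinarith [mul_nonneg h0 (by linarith : (0:ℝ) ≤ 1 / 3 - ℓ), mul_nonneg (mul_nonneg h0 h0) h0,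
      mul_nonneg (mul_nonneg h0 h0) (by linarith : (0:ℝ) ≤ 1 / 3 - ℓ)]
  have hpre : 0 ≤ 256 * (1 - ℓ) ^ 2 * (3 - ℓ) := by
    have : 0 ≤ 3 - ℓ := by linarith
    positivity
  have key : 4 * (8 * π * ((2 - ℓ) * (1 - ℓ) * (2 - 3 * ℓ))) * (8 * π * ((3 - ℓ) * (3 - 2 * ℓ) * (1 - ℓ)))
      - (-(64 * ((1 - ℓ) ^ 2 * (3 - ℓ)))) ^ 2 =
      256 * (1 - ℓ) ^ 2 * (3 - ℓ) * (π ^ 2 * ((2 - ℓ) * (2 - 3 * ℓ) * (3 - 2 * ℓ)) - 16 * (1 - ℓ) ^ 2 * (3 - ℓ)) := by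
    ring
  nlinarith [mul_nonneg hpre hbr]

/-- The determinant condition on `[0, 1/3]`: `d₃c₁₂² ≤ d₁(4d₂d₃ − c₂₃²)`, i.e.
`Δ = 2048π(1−ℓ)³(3−ℓ)(1−3ℓ)·G(ℓ) ≥ 0`, `G(ℓ) = π²(1−2ℓ)(2−ℓ)(2−3ℓ)(3−2ℓ) − 32(1−ℓ)²(3−9ℓ+4ℓ²)`
(`G ≥ 12 − 24ℓ + ℓ² + 40ℓ³ − 20ℓ⁴ > 0` with `π > 3`). [cite: Zhang2022LandauSiegel, §2 (2.10), (2.13)] -/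
theorem d3_c12_sq_le_d1_schur {ℓ : ℝ} (h0 : 0 ≤ ℓ) (h : ℓ ≤ 1 / 3) :
    (8 * π * ((3 - ℓ) * (3 - 2 * ℓ) * (1 - ℓ))) * (-(64 * ((1 - ℓ) ^ 2 * (1 - 3 * ℓ)))) ^ 2 ≤
      (8 * π * ((1 - ℓ) * (1 - 2 * ℓ) * (1 - 3 * ℓ))) *
        (4 * (8 * π * ((2 - ℓ) * (1 - ℓ) * (2 - 3 * ℓ))) * (8 * π * ((3 - ℓ) * (3 - 2 * ℓ) * (1 - ℓ)))
          - (-(64 * ((1 - ℓ) ^ 2 * (3 - ℓ)))) ^ 2) := by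
  have hpi := Real.pi_gt_three
  have hpi0 := Real.pi_pos
  have hX : 0 ≤ (1 - 2 * ℓ) * (2 - ℓ) * (2 - 3 * ℓ) * (3 - 2 * ℓ) := by
    have a : 0 ≤ 1 - 2 * ℓ := by linarith
    have b : 0 ≤ 2 - ℓ := by linarith
    have c : 0 ≤ 2 - 3 * ℓ := by linarith
    have d : 0 ≤ 3 - 2 * ℓ := by linarith
    positivity
  have hG : 0 ≤ π ^ 2 * ((1 - 2 * ℓ) * (2 - ℓ) * (2 - 3 * ℓ) * (3 - 2 * ℓ))
      - 32 * (1 - ℓ) ^ 2 * (3 - 9 * ℓ + 4 * ℓ ^ 2) := by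
    have h9 : 9 * ((1 - 2 * ℓ) * (2 - ℓ) * (2 - 3 * ℓ) * (3 - 2 * ℓ))
        ≤ π ^ 2 * ((1 - 2 * ℓ) * (2 - ℓ) * (2 - 3 * ℓ) * (3 - 2 * ℓ)) :=
      mul_le_mul_of_nonneg_right (by nlinarith) hX
    -- `9(…) − 32(1−ℓ)²(3−9ℓ+4ℓ²) = 12 − 24ℓ + ℓ² + 40ℓ³ − 20ℓ⁴ ≥ 0` on `[0, 1/3]`
    have hl3 : 0 ≤ ℓ ^ 3 := by positivity
    nlinarith [mul_nonneg hl3 (by linarith : (0:ℝ) ≤ 2 - ℓ), sq_nonneg ℓ]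
  have hpre : 0 ≤ 2048 * π * (1 - ℓ) ^ 3 * (3 - ℓ) * (1 - 3 * ℓ) := by
    have a : 0 ≤ 1 - ℓ := by linarith
    have b : 0 ≤ 3 - ℓ := by linarith
    have c : 0 ≤ 1 - 3 * ℓ := by linarith
    positivity
  have key : (8 * π * ((1 - ℓ) * (1 - 2 * ℓ) * (1 - 3 * ℓ))) *
        (4 * (8 * π * ((2 - ℓ) * (1 - ℓ) * (2 - 3 * ℓ))) * (8 * π * ((3 - ℓ) * (3 - 2 * ℓ) * (1 - ℓ)))
          - (-(64 * ((1 - ℓ) ^ 2 * (3 - ℓ)))) ^ 2)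
      - (8 * π * ((3 - ℓ) * (3 - 2 * ℓ) * (1 - ℓ))) * (-(64 * ((1 - ℓ) ^ 2 * (1 - 3 * ℓ)))) ^ 2 =
      2048 * π * (1 - ℓ) ^ 3 * (3 - ℓ) * (1 - 3 * ℓ) *
        (π ^ 2 * ((1 - 2 * ℓ) * (2 - ℓ) * (2 - 3 * ℓ) * (3 - 2 * ℓ))
          - 32 * (1 - ℓ) ^ 2 * (3 - 9 * ℓ + 4 * ℓ ^ 2)) := by
    ring
  nlinarith [mul_nonneg hpre hG]

/-- **PSD below one third**: for `0 ≤ ℓ ≤ 1/3` the pencil `H(ℓ) = F_ℓ|span{k₁,k₂,k₃}` is `≥ 0` on all of `ℂ³`.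
[cite: Zhang2022LandauSiegel, §2 (2.10), (2.13)] -/
theorem ellFormQ_nonneg_of_le_third {ℓ : ℝ} (h0 : 0 ≤ ℓ) (h : ℓ ≤ 1 / 3) (x₁ x₂ x₃ : ℂ) :
    0 ≤ ellFormQ ℓ x₁ x₂ x₃ := by
  have hpi0 := Real.pi_pos
  refine le_trans ?_ (ellFormQ_ge_moduli ℓ x₁ x₂ x₃)
  -- signs of the couplings on `[0, 1/3]`
  have hc12 : |64 * ((1 - ℓ) ^ 2 * (1 - 3 * ℓ))| = 64 * ((1 - ℓ) ^ 2 * (1 - 3 * ℓ)) :=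
    abs_of_nonneg (mul_nonneg (by norm_num) (mul_nonneg (sq_nonneg _) (by linarith)))
  have hc23 : |64 * ((1 - ℓ) ^ 2 * (3 - ℓ))| = 64 * ((1 - ℓ) ^ 2 * (3 - ℓ)) :=
    abs_of_nonneg (mul_nonneg (by norm_num) (mul_nonneg (sq_nonneg _) (by linarith)))
  rw [hc12, hc23]
  have hd1 : 0 ≤ 8 * π * ((1 - ℓ) * (1 - 2 * ℓ) * (1 - 3 * ℓ)) := by
    have a : 0 ≤ 1 - ℓ := by linarith
    have b : 0 ≤ 1 - 2 * ℓ := by linarith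
    have c : 0 ≤ 1 - 3 * ℓ := by linarith
    positivity
  have hd3 : 0 < 8 * π * ((3 - ℓ) * (3 - 2 * ℓ) * (1 - ℓ)) := by
    have a : 0 < 1 - ℓ := by linarith
    have b : 0 < 3 - ℓ := by linarith
    have c : 0 < 3 - 2 * ℓ := by linarith
    positivity
  have h := tridiag_nonneg hd1 hd3 (c23_sq_le_four_d23 h0 h) (d3_c12_sq_le_d1_schur h0 h) ‖x₁‖ ‖x₂‖ ‖x₃‖
  linarith

/-- At the endpoint `ℓ = 1/3` the direction `k₁` is NULL: `H(1/3)(x₁, 0, 0) = 0` (both its diagonal entry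
`8π(1−ℓ)(1−2ℓ)(1−3ℓ)` and its coupling `64(1−ℓ)²(1−3ℓ)` vanish). [cite: Zhang2022LandauSiegel, §2 (2.10), (2.13)] -/
theorem ellFormQ_third_afeDir_one (x₁ : ℂ) : ellFormQ (1 / 3) x₁ 0 0 = 0 := by
  unfold ellFormQ
  norm_num

/-! ## Indefinite on `(1/3, 1)` and on `(1, ∞)` -/

/-- The `span{k₁,k₂}` block loses its Schur condition on `(1/3, 1)`: `4d₁d₂ − c₁₂² < 0`, i.e.
`256(1−ℓ)²(1−3ℓ)·[π²(1−2ℓ)(2−ℓ)(2−3ℓ) + 16(1−ℓ)²(3ℓ−1)] < 0` (the bracket is `> 0` on `(1/3,1)`; on `(½, ⅔)`,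
where its first summand is negative, `π² < 9.93` suffices). [cite: Zhang2022LandauSiegel, §2 (2.10), (2.13)] -/
theorem four_d12_sub_c12_sq_neg {ℓ : ℝ} (h : 1 / 3 < ℓ) (h' : ℓ < 1) :
    4 * (8 * π * ((1 - ℓ) * (1 - 2 * ℓ) * (1 - 3 * ℓ))) * (8 * π * ((2 - ℓ) * (1 - ℓ) * (2 - 3 * ℓ)))
      - (64 * ((1 - ℓ) ^ 2 * (1 - 3 * ℓ))) ^ 2 < 0 := by
  have hpi := Real.pi_gt_three
  have hpi' := Real.pi_lt_d2
  have hpi0 := Real.pi_pos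
  have key : 4 * (8 * π * ((1 - ℓ) * (1 - 2 * ℓ) * (1 - 3 * ℓ))) * (8 * π * ((2 - ℓ) * (1 - ℓ) * (2 - 3 * ℓ)))
      - (64 * ((1 - ℓ) ^ 2 * (1 - 3 * ℓ))) ^ 2 =
      -(256 * (1 - ℓ) ^ 2 * (3 * ℓ - 1) *
        (π ^ 2 * ((1 - 2 * ℓ) * (2 - ℓ) * (2 - 3 * ℓ)) + 16 * (1 - ℓ) ^ 2 * (3 * ℓ - 1))) := by
    ring
  rw [key, neg_lt_zero]
  have hpre : 0 < 256 * (1 - ℓ) ^ 2 * (3 * ℓ - 1) := by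
    have a : 0 < 1 - ℓ := by linarith
    have b : 0 < 3 * ℓ - 1 := by linarith
    positivity
  have hpos16 : 0 < 16 * (1 - ℓ) ^ 2 * (3 * ℓ - 1) := by
    have a : 0 < 1 - ℓ := by linarith
    have b : 0 < 3 * ℓ - 1 := by linarith
    positivity
  have hbr : 0 < π ^ 2 * ((1 - 2 * ℓ) * (2 - ℓ) * (2 - 3 * ℓ)) + 16 * (1 - ℓ) ^ 2 * (3 * ℓ - 1) := by
    rcases le_or_gt ℓ (1 / 2) with h1 | h1
    · -- `(1/3, 1/2]`: the cubic is `≥ 0`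
      have hX : 0 ≤ (1 - 2 * ℓ) * (2 - ℓ) * (2 - 3 * ℓ) := by
        have a : 0 ≤ 1 - 2 * ℓ := by linarith
        have b : 0 ≤ 2 - ℓ := by linarith
        have c : 0 ≤ 2 - 3 * ℓ := by linarith
        positivity
      nlinarith [mul_nonneg (sq_nonneg π) hX]
    rcases lt_or_ge ℓ (2 / 3) with h2 | h2
    · -- `(1/2, 2/3)`: `π²·|cubic| ≤ 9.93·(2ℓ−1)(2−ℓ)(2−3ℓ) < 16(1−ℓ)²(3ℓ−1)`
      have hY : 0 ≤ (2 * ℓ - 1) * (2 - ℓ) * (2 - 3 * ℓ) := by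
        have a : 0 ≤ 2 * ℓ - 1 := by linarith
        have b : 0 ≤ 2 - ℓ := by linarith
        have c : 0 ≤ 2 - 3 * ℓ := by linarith
        positivity
      have hp2 : π ^ 2 ≤ 10 := by nlinarith
      have h10 : π ^ 2 * ((2 * ℓ - 1) * (2 - ℓ) * (2 - 3 * ℓ)) ≤ 10 * ((2 * ℓ - 1) * (2 - ℓ) * (2 - 3 * ℓ)) :=
        mul_le_mul_of_nonneg_right hp2 hY
      -- `f(ℓ) = 16(1−ℓ)²(3ℓ−1) − 10(2ℓ−1)(2−ℓ)(2−3ℓ) = −12ℓ³ + 78ℓ² − 80ℓ + 24 > 0` on `[1/2, 2/3]`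
      nlinarith [mul_nonneg (by linarith : (0:ℝ) ≤ ℓ - 1 / 2) (by linarith : (0:ℝ) ≤ 2 / 3 - ℓ),
        sq_nonneg (ℓ - 3 / 5), mul_nonneg (sq_nonneg (ℓ - 3 / 5)) (by linarith : (0:ℝ) ≤ ℓ - 1 / 2)]
    · -- `[2/3, 1)`: the cubic is `≥ 0` again
      have hX : 0 ≤ (1 - 2 * ℓ) * (2 - ℓ) * (2 - 3 * ℓ) := by
        have e : (1 - 2 * ℓ) * (2 - ℓ) * (2 - 3 * ℓ) = (2 * ℓ - 1) * (2 - ℓ) * (3 * ℓ - 2) := by ring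
        rw [e]
        have a : 0 ≤ 2 * ℓ - 1 := by linarith
        have b : 0 ≤ 2 - ℓ := by linarith
        have c : 0 ≤ 3 * ℓ - 2 := by linarith
        positivity
      nlinarith [mul_nonneg (sq_nonneg π) hX]
  exact mul_pos hpre hbr

/-- The two-frequency witness family: for real `r, s`, `H(ℓ)(r, i·s, 0) = d₁r² + d₂s² + c₁₂·r·s` with
`c₁₂ = 64(1−ℓ)²(1−3ℓ)` (`< 0` for `ℓ > 1/3`). [cite: Zhang2022LandauSiegel, §2 (2.10), (2.13)] -/
theorem ellFormQ_witness12 (ℓ r s : ℝ) :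
    ellFormQ ℓ (r : ℂ) (Complex.I * (s : ℂ)) 0 =
      8 * π * ((1 - ℓ) * (1 - 2 * ℓ) * (1 - 3 * ℓ)) * r ^ 2
        + 8 * π * ((2 - ℓ) * (1 - ℓ) * (2 - 3 * ℓ)) * s ^ 2
        + 64 * ((1 - ℓ) ^ 2 * (1 - 3 * ℓ)) * (r * s) := by
  unfold ellFormQ
  have h1 : ‖(r : ℂ)‖ ^ 2 = r ^ 2 := by rw [Complex.norm_real, Real.norm_eq_abs, sq_abs]
  have h2 : ‖Complex.I * (s : ℂ)‖ ^ 2 = s ^ 2 := by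
    rw [norm_mul, Complex.norm_I, one_mul, Complex.norm_real, Real.norm_eq_abs, sq_abs]
  have h3 : ((r : ℂ) * conj (Complex.I * (s : ℂ))).im = -(r * s) := by
    simp [Complex.mul_im]
  rw [h1, h2, h3]
  simp

/-- **Indefinite between one third and one**: for `1/3 < ℓ < 1` some `x ∈ ℂ³` has `H(ℓ)(x) < 0` (witness
`(2d₂, −i c₁₂, 0)` for `ℓ ≤ ½`, `(−c₁₂, 2i d₁, 0)` for `ℓ > ½`; value `d₂(4d₁d₂ − c₁₂²)` resp. `d₁(4d₁d₂ − c₁₂²)`).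
[cite: Zhang2022LandauSiegel, §2 (2.10), (2.13)] -/
theorem ellFormQ_neg_exists_of_third_lt_lt_one {ℓ : ℝ} (h : 1 / 3 < ℓ) (h' : ℓ < 1) :
    ∃ x₁ x₂ x₃ : ℂ, ellFormQ ℓ x₁ x₂ x₃ < 0 := by
  have hpi0 := Real.pi_pos
  have hM := four_d12_sub_c12_sq_neg h h'
  set d₁ : ℝ := 8 * π * ((1 - ℓ) * (1 - 2 * ℓ) * (1 - 3 * ℓ)) with hd₁
  set d₂ : ℝ := 8 * π * ((2 - ℓ) * (1 - ℓ) * (2 - 3 * ℓ)) with hd₂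
  set c : ℝ := 64 * ((1 - ℓ) ^ 2 * (1 - 3 * ℓ)) with hc
  rcases le_or_gt ℓ (1 / 2) with h1 | h1
  · -- `r = 2d₂`, `s = −c`: value `d₂(4d₁d₂ − c²)`, `d₂ > 0`
    refine ⟨((2 * d₂ : ℝ) : ℂ), Complex.I * ((-c : ℝ) : ℂ), 0, ?_⟩
    rw [ellFormQ_witness12]
    have hd2pos : 0 < d₂ := by
      have a : 0 < 1 - ℓ := by linarith
      have b : 0 < 2 - ℓ := by linarith
      have e : 0 < 2 - 3 * ℓ := by linarith
      rw [hd₂]; positivity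
    have e : d₁ * (2 * d₂) ^ 2 + d₂ * (-c) ^ 2 + c * (2 * d₂ * -c) = d₂ * (4 * d₁ * d₂ - c ^ 2) := by ring
    rw [e]
    exact mul_neg_of_pos_of_neg hd2pos hM
  · -- `r = −c`, `s = 2d₁`: value `d₁(4d₁d₂ − c²)`, `d₁ > 0`
    refine ⟨((-c : ℝ) : ℂ), Complex.I * ((2 * d₁ : ℝ) : ℂ), 0, ?_⟩
    rw [ellFormQ_witness12]
    have hd1pos : 0 < d₁ := by
      have e : d₁ = 8 * π * ((1 - ℓ) * (2 * ℓ - 1) * (3 * ℓ - 1)) := by rw [hd₁]; ring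
      rw [e]
      have a : 0 < 1 - ℓ := by linarith
      have b : 0 < 2 * ℓ - 1 := by linarith
      have d : 0 < 3 * ℓ - 1 := by linarith
      positivity
    have e : d₁ * (-c) ^ 2 + d₂ * (2 * d₁) ^ 2 + c * (-c * (2 * d₁)) = d₁ * (4 * d₁ * d₂ - c ^ 2) := by ring
    rw [e]
    exact mul_neg_of_pos_of_neg hd1pos hM

/-- Above the physical point `k₁` alone is negative: `H(ℓ)(1,0,0) = 8π(1−ℓ)(1−2ℓ)(1−3ℓ) < 0` for `ℓ > 1`
(= CONTROL C2 / `mainTermFormEll_neg_of_one_lt` in pencil form). [cite: Zhang2022LandauSiegel, §2 (2.10), (2.13)] -/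
theorem ellFormQ_afeDir_one_neg_of_one_lt {ℓ : ℝ} (h : 1 < ℓ) : ellFormQ ℓ 1 0 0 < 0 := by
  have hpi0 := Real.pi_pos
  have e : ellFormQ ℓ 1 0 0 = -(8 * π * ((ℓ - 1) * (2 * ℓ - 1) * (3 * ℓ - 1))) := by
    unfold ellFormQ; simp; ring
  rw [e, neg_lt_zero]
  have a : 0 < ℓ - 1 := by linarith
  have b : 0 < 2 * ℓ - 1 := by linarith
  have c : 0 < 3 * ℓ - 1 := by linarith
  positivity

/-! ## The chart -/

/-- **SIGN CHART of the pencil on the AFE span** (`ℓ ≥ 0`): `H(ℓ) ⪰ 0 ↔ ℓ ≤ 1/3 ∨ ℓ = 1`.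
[cite: Zhang2022LandauSiegel, §2 (2.10), (2.13)] -/
theorem ellFormQ_nonneg_iff {ℓ : ℝ} (h0 : 0 ≤ ℓ) :
    (∀ x₁ x₂ x₃ : ℂ, 0 ≤ ellFormQ ℓ x₁ x₂ x₃) ↔ ℓ ≤ 1 / 3 ∨ ℓ = 1 := by
  constructor
  · intro hall
    rcases le_or_gt ℓ (1 / 3) with h13 | h13
    · exact Or.inl h13
    right
    by_contra hne1
    rcases lt_or_gt_of_ne hne1 with hlt | hgt
    · obtain ⟨x₁, x₂, x₃, hx⟩ := ellFormQ_neg_exists_of_third_lt_lt_one h13 hlt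
      exact absurd (hall x₁ x₂ x₃) (not_le.mpr hx)
    · exact absurd (hall 1 0 0) (not_le.mpr (ellFormQ_afeDir_one_neg_of_one_lt hgt))
  · rintro (h13 | rfl) x₁ x₂ x₃
    · exact ellFormQ_nonneg_of_le_third h0 h13 x₁ x₂ x₃
    · rw [ellFormQ_one]

/-- The chart, transported to the continued main-term form on profiles: for `ℓ ≥ 0`,
`(∀ x, 0 ≤ F_ℓ(x₁k₁ + x₂k₂ + x₃k₃)) ↔ ℓ ≤ 1/3 ∨ ℓ = 1` (part 6's `mainTermFormEll_afeComb`).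
[cite: Zhang2022LandauSiegel, §2 (2.10), (2.13)] -/
theorem mainTermFormEll_afeSpan_nonneg_iff {ℓ : ℝ} (h0 : 0 ≤ ℓ) :
    (∀ x₁ x₂ x₃ : ℂ, 0 ≤ mainTermFormEll ℓ (fun y => x₁ * afeDir 1 y + x₂ * afeDir 2 y + x₃ * afeDir 3 y)
        (fun y => x₁ * afeDir' 1 y + x₂ * afeDir' 2 y + x₃ * afeDir' 3 y)) ↔ ℓ ≤ 1 / 3 ∨ ℓ = 1 := by
  simp only [mainTermFormEll_afeComb]
  exact ellFormQ_nonneg_iff h0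

/-! ## Appended: the null space at the endpoint `ℓ = 1/3`, and cross-references

CROSS-REFERENCE (read after landing; recorded here for the books). The NEGATIVE half of the chart — some profile
with `F_ℓ < 0` for every `ℓ > 1/3`, `ℓ ≠ 1`, and `ℓ = 1` as the only positivity point beyond `1/3` — was already in
the tree on the full profile class `C¹[0,1]`: `Det.mainTermFormEll_exists_neg_of_third_lt` and
`Det.eq_one_of_mainTermFormEll_nonneg` (`MainTermFormEllRecipe`, Part 10, ls-knife-typer-2; witnesses `k₁`, `k₂`,
`k₁ + (i/2)k₂`, and the sign box `Det.signAdmissible_ellRecipe_iff`). What this file adds is the POSITIVE half on the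
AFE span (`ellFormQ_nonneg_of_le_third`: PSD on `span{k₁,k₂,k₃}` for `0 ≤ ℓ ≤ 1/3`), hence the `iff` ON THAT SPAN, and
below the exact null space at the endpoint. DESK OBSERVATION (numerics, uncertified, seat folder scratch/fell_leg.py:
shifted-Legendre basis of degree ≤ 10, `H¹`-normalised generalized eigenvalues): the minimum of `F_ℓ(g)/‖g‖²_{H¹}` over
that 11-dimensional space is `> 0` for `ℓ ∈ (0, 1/3)` (`0.159, 0.195, 0.053, 0.0052` at `ℓ = 0.1, 0.2, 0.3, 0.33`),
`≈ 0` at `ℓ = 1/3` and `< 0` from `ℓ = 0.335` on — consistent with the CONJECTURE that the positivity set of `F_ℓ`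
on all of `C¹[0,1]` is `[0, 1/3] ∪ {1}` (the lowest quarter-wave eigenvalue of the deformed Dirichlet–Neumann bulk
form is `π⁴(1−ℓ²)(1−9ℓ²)/16`, vanishing exactly at `ℓ = 1/3` and `ℓ = 1`); NOT claimed here — the `C¹` statement for
`ℓ ≤ 1/3` is open in the tree. -/

/-- **The null space at `ℓ = 1/3` on the AFE span is exactly `ℂ·k₁`**: `H(1/3)(x) = 0 ↔ x₂ = 0 ∧ x₃ = 0`
(the `span{k₂,k₃}` block is positive DEFINITE there: `4d₂d₃ = 286720π²/243 > (2048/27)² = c₂₃²`).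
[cite: Zhang2022LandauSiegel, §2 (2.10), (2.13)] -/
theorem ellFormQ_third_eq_zero_iff (x₁ x₂ x₃ : ℂ) :
    ellFormQ (1 / 3) x₁ x₂ x₃ = 0 ↔ x₂ = 0 ∧ x₃ = 0 := by
  constructor
  · intro h0
    have hpi := Real.pi_gt_three
    have hge := ellFormQ_ge_moduli (1 / 3) x₁ x₂ x₃
    norm_num at hge
    rw [h0] at hge
    -- `hge : 80π/9·‖x₂‖² + 896π/27·‖x₃‖² − 2048/27·(‖x₂‖‖x₃‖) ≤ 0` (the `k₁` row vanishes)
    have h2 : 0 ≤ ‖x₂‖ := norm_nonneg _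
    have h3 : 0 ≤ ‖x₃‖ := norm_nonneg _
    have hr : 3 * ‖x₂‖ ^ 2 ≤ π * ‖x₂‖ ^ 2 := mul_le_mul_of_nonneg_right hpi.le (sq_nonneg _)
    have hs : 3 * ‖x₃‖ ^ 2 ≤ π * ‖x₃‖ ^ 2 := mul_le_mul_of_nonneg_right hpi.le (sq_nonneg _)
    have key : 80 / 3 * ‖x₂‖ ^ 2 + 896 / 9 * ‖x₃‖ ^ 2 ≤ 2048 / 27 * (‖x₂‖ * ‖x₃‖) := by nlinarith
    -- the binary form `80/3·r² − 2048/27·rs + 896/9·s²` is positive definite (`t = 64/45`)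
    have hsq : ‖x₂‖ ^ 2 = 0 ∧ ‖x₃‖ ^ 2 = 0 := by
      constructor <;>
        nlinarith [sq_nonneg (‖x₂‖ - 64 / 45 * ‖x₃‖), mul_nonneg h2 h3, sq_nonneg ‖x₂‖, sq_nonneg ‖x₃‖]
    exact ⟨norm_eq_zero.mp (pow_eq_zero_iff two_ne_zero |>.mp hsq.1),
      norm_eq_zero.mp (pow_eq_zero_iff two_ne_zero |>.mp hsq.2)⟩
  · rintro ⟨rfl, rfl⟩
    exact ellFormQ_third_afeDir_one x₁

/-- Hence at `ℓ = 1/3` the pencil is PSD with a ONE-dimensional kernel on the AFE span (the chart's endpoint is a simple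
crossing of the `k₁` eigenvalue `8π(1−ℓ)(1−2ℓ)(1−3ℓ)`). [cite: Zhang2022LandauSiegel, §2 (2.10), (2.13)] -/
theorem ellFormQ_third_pos_of_ne {x₁ x₂ x₃ : ℂ} (h : x₂ ≠ 0 ∨ x₃ ≠ 0) : 0 < ellFormQ (1 / 3) x₁ x₂ x₃ := by
  have h0 := ellFormQ_nonneg_of_le_third (le_of_lt (by norm_num : (0:ℝ) < 1 / 3)) le_rfl x₁ x₂ x₃
  rcases eq_or_lt_of_le h0 with heq | hlt
  · exfalso
    obtain ⟨h2, h3⟩ := (ellFormQ_third_eq_zero_iff x₁ x₂ x₃).mp heq.symm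
    rcases h with h | h
    · exact h h2
    · exact h h3
  · exact hlt

end Objective

end Literature.NumberTheory.LFunctions.Zhang2022
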